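import Literature.Geometry.GeometricMeasureTheory.ClosureTheoremCycles
import Literature.Geometry.GeometricMeasureTheory.IntegralCurrentsClosureDimZero
import Literature.Geometry.GeometricMeasureTheory.CurrentsNullSupport
import HarnessLib

/-!
# The closure theorem and the Federer–Fleming compactness theorem

This file completes the proof of the named fact
`Literature.Geometry.GeometricMeasureTheory.Federer1969_compactness_integralCurrents`
(Federer–Fleming compactness for integral currents [Federer1969, 4.2.17 (2)]) along B. White's
structure-theorem-free proof of the closure theorem [White1989]; the reduction of compactness to
the rectifiability of weak limits is `Federer1969_compactness_of_rectifiableLimit`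
(`IntegralCurrentsClosureDimZero`), and the rectifiability of weak limits of rectifiable CYCLES is
`Current.isRectifiable_of_tendsto_cycles` (`ClosureTheoremCycles`).

Here: (1) the cone operator `Z ↦ δ_{x₀} ⨯ Z = h_#([0,1] × Z)` is weakly continuous on mass-bounded
sequences (dominated convergence in `([0,1] × Z)(ψ) = ∫₀¹ Z(ψ^t) dt`); (2) **boundary reduction**:
for integral currents `Tᵢ → T`, the currents `Sᵢ = Tᵢ − δ₀ ⨯ ∂Tᵢ = ∂(δ₀ ⨯ Tᵢ)` are rectifiable
cycles of bounded mass and support converging to `T − δ₀ ⨯ ∂T`, which is therefore rectifiable,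
and `δ₀ ⨯ ∂T` is rectifiable because `∂T` is (induction on the dimension, the base case being the
closure theorem in dimension `0`); (3) induction on the dimension gives the rectifiability of weak
limits of `𝐍`-bounded sequences of integral currents, hence the compactness theorem.

* `Current.tendsto_pushforward_prodInterval_apply` — weak continuity of `Z ↦ H_#([0,1] × Z)`;
* `Current.support_cone_subset` — `spt(δ_{x₀} ⨯ Z) ⊆ 𝐁(x₀, r)` if `spt Z ⊆ 𝐁(x₀, r)`;
* `Current.isRectifiable_of_tendsto_integral_of_boundary` — boundary reduction;
* **`Current.isRectifiable_of_tendsto_integral`** — weak limits of `𝐍`-bounded sequences of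
  integral currents with supports in a compact set are rectifiable [Federer1969, 4.2.16];
* **`Federer1969_compactness_integralCurrents_holds`** — the discharge.

## References

* B. White, *A new proof of the compactness theorem for integral currents*, Comment. Math. Helv.
  64 (1989) 207–220 [White1989].
* L. Bandara, *The closure theorem for integral currents without the structure theorem*,
  B.Sc. thesis, ANU 2006, Thm. 4.2.1 and §4.3 (held copy `lit paper:galaxy-pdf-8023002039701172160`)
  [Bandara2006].
* H. Federer, *Geometric Measure Theory*, Springer 1969, 4.1.8, 4.1.11, 4.2.16, 4.2.17
  [Federer1969].
-/

noncomputable section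

open scoped ENNReal NNReal Topology Distributions
open MeasureTheory TopologicalSpace Set Filter Metric Function

namespace Literature.Geometry.GeometricMeasureTheory

-- Nested operator-norm instances on (duals of) `E [⋀^Fin m]→L[ℝ] ℝ`, as in `Currents.lean`.
set_option maxSynthPendingDepth 3

/-! ### Weak continuity of the cone operator -/

section ConeContinuity

variable {E : Type*} [NormedAddCommGroup E] [NormedSpace ℝ E]
  {E' : Type*} [NormedAddCommGroup E'] [NormedSpace ℝ E'] {Ω : Opens E} {Ω' : Opens E'} {m : ℕ}

/-- **`Z ↦ H_#([0,1] × Z)` is weakly continuous on mass-bounded sequences**: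
`(H_#([0,1] × Zᵢ))(φ) = ∫₀¹ Zᵢ((χ H^# φ)^t) dt → ∫₀¹ Z((χ H^# φ)^t) dt` by dominated convergence,
the integrands being bounded by `𝐌(Zᵢ) sup ‖χ H^# φ‖ ≤ c · C`. [cite: Federer1969, 4.1.8, 4.1.9] -/
theorem Current.tendsto_pushforward_prodInterval_apply {Z : ℕ → Current Ω m} {Z' : Current Ω m}
    {c : ℝ≥0∞} (hc : c ≠ ⊤) (hmass : ∀ i, (Z i).mass ≤ c)
    (hconv : ∀ φ, Tendsto (fun i => Z i φ) atTop (𝓝 (Z' φ))) (χ : 𝓓(cylinder Ω, ℝ))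
    {H : ℝ × E → E'} (hH : ContDiff ℝ ((⊤ : ℕ∞) : WithTop ℕ∞) H) (φ : TestForm Ω' (m + 1)) :
    Tendsto (fun i => ((Z i).prodInterval 0 1).pushforward Ω' χ hH φ) atTop
      (𝓝 ((Z'.prodInterval 0 1).pushforward Ω' χ hH φ)) := by
  simp only [Current.pushforward_apply, Current.prodInterval_apply]
  set ψ : TestForm (cylinder Ω) (m + 1) := TestForm.pullback χ hH φ with hψ
  obtain ⟨C, hC, hCψ⟩ := TestForm.exists_norm_le ψ
  have hmi : ∀ i, (Z i).mass ≠ ⊤ := fun i => ne_top_of_le_ne_top hc (hmass i)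
  have hslice : ∀ t x, ‖TestForm.tslice ψ t x‖ ≤ C := fun t x => by
    rw [TestForm.tslice_apply]
    exact (norm_covSlice_le _).trans (hCψ _)
  refine intervalIntegral.tendsto_integral_filter_of_dominated_convergence (fun _ => C * c.toReal)
    (Eventually.of_forall fun i =>
      ((Z i).continuous_apply_sliceBy' _ ψ).aestronglyMeasurable) (Eventually.of_forall fun i =>
      Eventually.of_forall fun t _ => ?_) intervalIntegrable_const
    (Eventually.of_forall fun t _ => hconv _)
  rw [Real.norm_eq_abs]
  refine ((Z i).abs_apply_le_mul_toReal_mass (hmi i) hC (hslice t)).trans ?_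
  exact mul_le_mul_of_nonneg_left (ENNReal.toReal_mono hc (hmass i)) hC.le

end ConeContinuity

variable {V : Type*} [NormedAddCommGroup V] [InnerProductSpace ℝ V] [FiniteDimensional ℝ V]
  [MeasurableSpace V] [BorelSpace V]

/-! ### The cone over a localised current -/

section Cone

variable {m : ℕ}

omit [MeasurableSpace V] [BorelSpace V] in
/-- **`spt(δ_{x₀} ⨯ Z) ⊆ 𝐁(x₀, r)`** when `spt Z ⊆ 𝐁(x₀, r)`, for the affine homotopy
`h(t, x) = x₀ + t(x − x₀)` (any dimension, any cutoff). [cite: Federer1969, 4.1.11] -/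
theorem Current.support_cone_subset (x₀ : V) (χ : 𝓓((⊤ : Opens V), ℝ)) {r : ℝ}
    (Z : Current (⊤ : Opens V) m) (hZ : Z.support ⊆ closedBall x₀ r) :
    ((Z.prodInterval 0 1).pushforward ⊤ (TestFunction.tensorCutoff timeCutoff χ)
        (contDiff_affineHomotopy (contDiff_const (c := x₀)) contDiff_id)).support ⊆
      closedBall x₀ r := by
  refine ((Z.prodInterval 0 1).support_pushforward_subset _ _).trans
    (closure_minimal ?_ isClosed_closedBall)
  rintro _ ⟨p, ⟨-, hp⟩, rfl⟩
  obtain ⟨ht, hx⟩ := Z.support_prodInterval_subset 0 1 hp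
  rw [Set.uIcc_of_le zero_le_one] at ht
  have hx' : ‖p.2 - x₀‖ ≤ r := by rw [← dist_eq_norm]; exact hZ hx
  rw [mem_closedBall, dist_eq_norm]
  change ‖(x₀ + p.1 • (id p.2 - x₀)) - x₀‖ ≤ r
  rw [add_sub_cancel_left, norm_smul, Real.norm_of_nonneg ht.1, id]
  calc p.1 * ‖p.2 - x₀‖ ≤ 1 * ‖p.2 - x₀‖ := mul_le_mul_of_nonneg_right ht.2 (norm_nonneg _)
    _ ≤ r := by rw [one_mul]; exact hx'

end Cone

/-! ### Boundary reduction and the closure theorem -/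

section Closure

variable {m : ℕ}

/-- **Boundary reduction** ([White1989, p. 211]; [Bandara2006, §4.3]): let integral
`(m+1)`-currents `Tᵢ` with `spt Tᵢ ⊆ K` compact and `𝐍(Tᵢ) ≤ c` converge weakly to `T`. If `∂T`
is rectifiable and weak limits of rectifiable `m`-dimensional boundaries of bounded mass and
support are rectifiable, then `T` is rectifiable: `Sᵢ = Tᵢ − δ₀ ⨯ ∂Tᵢ = ∂(δ₀ ⨯ Tᵢ)` are
rectifiable cycles converging to `T − δ₀ ⨯ ∂T` (weak continuity of the cone), rectifiable by
`Current.isRectifiable_of_tendsto_cycles`, and `δ₀ ⨯ ∂T` is rectifiable.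
[cite: White1989, p. 211; Federer1969, 4.1.11, 4.2.16] -/
theorem Current.isRectifiable_of_tendsto_integral_of_boundary
    (IH : ∀ (K' : Set V), IsCompact K' → ∀ (c' : ℝ≥0∞), c' ≠ ⊤ →
      ∀ (Q : ℕ → Current (⊤ : Opens V) (m + 1)) (Z' : Current (⊤ : Opens V) m),
        (∀ i, (Q i).boundary.IsRectifiable ∧ (Q i).boundary.support ⊆ K' ∧
          (Q i).boundary.mass ≤ c') →
        (∀ φ, Tendsto (fun i => (Q i).boundary φ) atTop (𝓝 (Z' φ))) → Z'.IsRectifiable)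
    {K : Set V} (hK : IsCompact K) {c : ℝ≥0∞} (hc : c ≠ ⊤)
    {T : ℕ → Current (⊤ : Opens V) (m + 1)} {T' : Current (⊤ : Opens V) (m + 1)}
    (hT : ∀ i, (T i).IsIntegral ∧ (T i).support ⊆ K ∧ (T i).normalMass ≤ c)
    (hconv : ∀ φ, Tendsto (fun i => T i φ) atTop (𝓝 (T' φ)))
    (hbd : T'.boundary.IsRectifiable) : T'.IsRectifiable := by
  classical
  by_cases hdim : m + 1 ≤ Module.finrank ℝ V
  swap
  · -- above the top dimension every rectifiable current vanishes
    have h0 : ∀ i, T i = 0 := fun i => by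
      have hr : (T i).IsRectifiable := (hT i).1.1
      exact hr.1.eq_zero_of_finrank_lt (by omega)
    have hT'0 : T' = 0 := by
      ext φ
      have h : Tendsto (fun _ : ℕ => (0 : ℝ)) atTop (𝓝 (T' φ)) :=
        (hconv φ).congr fun i => by rw [h0 i]; rfl
      exact tendsto_nhds_unique h tendsto_const_nhds
    rw [hT'0]
    exact Current.isRectifiable_zero
  -- supports in a ball, a cutoff, the cones
  have hT'K : T'.support ⊆ K :=
    Current.support_subset_of_tendsto hconv hK.isClosed fun i => (hT i).2.1
  obtain ⟨r₀, hr₀⟩ := hK.isBounded.subset_closedBall (0 : V)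
  set r : ℝ := max r₀ 1 with hr
  have hr0 : 0 < r := lt_of_lt_of_le one_pos (le_max_right _ _)
  have hKr : K ⊆ closedBall (0 : V) r := hr₀.trans (closedBall_subset_closedBall (le_max_left _ _))
  obtain ⟨χ, U, hU, hKU, hχ1, hχabs, hχR⟩ := exists_testFunction_eq_one_nhds_subset
    (Ω := (⊤ : Opens V)) (K := closedBall (0 : V) r) (N := ball 0 (r + 1)) (isCompact_closedBall _ _)
    isOpen_ball (fun _ _ => trivial) (closedBall_subset_ball (by linarith))
  obtain ⟨hVo, h01, hρ1, hρabs, hρ2⟩ := timeCutoff_spec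
  have hH := contDiff_affineHomotopy (contDiff_const (c := (0 : V))) (contDiff_id (𝕜 := ℝ) (E := V))
  -- the cone `δ₀ ⨯ Z` of an `m`-current `Z`
  set Kc : Current (⊤ : Opens V) m → Current (⊤ : Opens V) (m + 1) := fun Z =>
    (Z.prodInterval 0 1).pushforward ⊤ (TestFunction.tensorCutoff timeCutoff χ) hH with hKc
  have hKc_rect : ∀ Z : Current (⊤ : Opens V) m, Z.IsRectifiable → Z.support ⊆ K →
      (Kc Z).IsRectifiable := fun Z hZ hZK => by
    refine hZ.pushforward_prodInterval_top _ (fun p hp => ?_) _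
    rw [TestFunction.tensorCutoff_apply, hρ1 _ (h01 hp.1), hχ1 _ (hKU (hKr (hZK hp.2))), one_mul]
  have hKc_supp : ∀ Z : Current (⊤ : Opens V) m, Z.support ⊆ K →
      (Kc Z).support ⊆ closedBall 0 r := fun Z hZK =>
    Z.support_cone_subset 0 χ (hZK.trans hKr)
  have hKc_mass : ∀ Z : Current (⊤ : Opens V) m,
      (Kc Z).mass ≤ ENNReal.ofReal ((r + 1) * (1 + 1) ^ m) * Z.mass := fun Z =>
    Z.mass_cone_le (Ω' := (⊤ : Opens V)) χ timeCutoff 0 (by linarith) zero_le_one hχabs hρabs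
      (fun x hx => by rw [sub_zero, ← dist_zero_right]; exact (mem_ball.1 (hχR hx)).le)
      (fun t ht => by norm_num; exact hρ2 t ht)
  -- the cycles `Sᵢ = Tᵢ − δ₀ ⨯ ∂Tᵢ`
  set S : ℕ → Current (⊤ : Opens V) (m + 1) := fun i => T i - Kc (T i).boundary with hS
  have hTi_m : ∀ i, (T i).mass ≤ c := fun i => le_self_add.trans (hT i).2.2
  have hdTi_m : ∀ i, (T i).boundary.mass ≤ c := fun i => le_add_self.trans (hT i).2.2
  have hScyc : ∀ i, (S i).boundary = 0 := fun i => by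
    have hform := (T i).cone_formula (Ω := (⊤ : Opens V)) χ timeCutoff (0 : V) hU
      ((hT i).2.1.trans (hKr.trans hKU)) hχ1 hVo h01 hρ1
    have hSeq : S i = (((T i).prodInterval 0 1).pushforward ⊤
        (TestFunction.tensorCutoff timeCutoff χ) hH).boundary := by
      rw [hS]
      dsimp only
      rw [sub_eq_iff_eq_add]
      exact hform
    rw [hSeq, Current.boundary_boundary]
  have hSrect : ∀ i, (S i).IsRectifiable := fun i =>
    (hT i).1.1.sub_top (hKc_rect _ (hT i).1.2 ((T i).support_boundary_subset.trans (hT i).2.1))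
  have hSsupp : ∀ i, (S i).support ⊆ closedBall 0 r := fun i =>
    (Current.support_sub_subset _ _).trans (union_subset ((hT i).2.1.trans hKr)
      (hKc_supp _ ((T i).support_boundary_subset.trans (hT i).2.1)))
  set c' : ℝ≥0∞ := c + ENNReal.ofReal ((r + 1) * (1 + 1) ^ m) * c with hc'
  have hc'top : c' ≠ ⊤ := ENNReal.add_ne_top.2 ⟨hc, ENNReal.mul_ne_top ENNReal.ofReal_ne_top hc⟩
  have hSmass : ∀ i, (S i).mass ≤ c' := fun i =>
    (Current.mass_sub_le_add _ _).trans (add_le_add (hTi_m i)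
      ((hKc_mass _).trans (by gcongr; exact hdTi_m i)))
  -- convergence `Sᵢ → T − δ₀ ⨯ ∂T`
  have hSconv : ∀ φ, Tendsto (fun i => S i φ) atTop (𝓝 ((T' - Kc T'.boundary) φ)) := by
    intro φ
    have h1 := Current.tendsto_pushforward_prodInterval_apply (Ω' := (⊤ : Opens V)) hc hdTi_m
      (Current.tendsto_boundary_apply hconv) (TestFunction.tensorCutoff timeCutoff χ) hH φ
    exact (hconv φ).sub h1
  -- the cycle case of the closure theorem
  have hSlim : (T' - Kc T'.boundary).IsRectifiable :=
    Current.isRectifiable_of_tendsto_cycles hdim IH (isCompact_closedBall (0 : V) r) hc'top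
      (T := S) (fun i => ⟨hSrect i, hScyc i, hSsupp i, hSmass i⟩) hSconv
  have hKT' : (Kc T'.boundary).IsRectifiable :=
    hKc_rect _ hbd (T'.support_boundary_subset.trans hT'K)
  have h := hSlim.add_top hKT'
  rwa [sub_add_cancel] at h

/-- **The closure theorem** [Federer1969, 4.2.16 (1)], in White's form [White1989]: weak limits
of `𝐍`-bounded sequences of integral `(m+1)`-currents supported in a fixed compact set are
rectifiable currents (by induction on `m`: the boundary is rectifiable by the theorem one dimension
lower — in dimension `0` by `Current.isRectifiable_of_tendsto_zero` — and then
`Current.isRectifiable_of_tendsto_integral_of_boundary` applies).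
[cite: White1989, Theorem p. 207; Federer1969, 4.2.16; Bandara2006, Thm. 4.2.1] -/
theorem Current.isRectifiable_of_tendsto_integral (m : ℕ) {K : Set V} (hK : IsCompact K)
    {c : ℝ≥0∞} (hc : c ≠ ⊤)
    {T : ℕ → Current (⊤ : Opens V) (m + 1)} {T' : Current (⊤ : Opens V) (m + 1)}
    (hT : ∀ i, (T i).IsIntegral ∧ (T i).support ⊆ K ∧ (T i).normalMass ≤ c)
    (hconv : ∀ φ, Tendsto (fun i => T i φ) atTop (𝓝 (T' φ))) : T'.IsRectifiable := by
  induction m generalizing K c with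
  | zero =>
    refine Current.isRectifiable_of_tendsto_integral_of_boundary (fun K' hK' c' hc' Q Z' hQ hQc =>
      ?_) hK hc hT hconv (Current.isRectifiable_boundary_of_tendsto_one hK hc hT hconv)
    exact Current.isRectifiable_of_tendsto_zero hK' hc' (T := fun i => (Q i).boundary)
      (fun i => ⟨(hQ i).1, (hQ i).2.1, (hQ i).2.2⟩) hQc
  | succ m ih =>
    refine Current.isRectifiable_of_tendsto_integral_of_boundary (fun K' hK' c' hc' Q Z' hQ hQc =>
      ?_) hK hc hT hconv ?_
    · refine ih hK' hc' (T := fun i => (Q i).boundary) (fun i => ⟨⟨(hQ i).1, ?_⟩, (hQ i).2.1, ?_⟩)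
        hQc
      · rw [Current.boundary_boundary]
        exact Current.isRectifiable_zero
      · show (Q i).boundary.mass + (Q i).boundary.boundary.mass ≤ c'
        rw [Current.boundary_boundary, Current.mass_zero, add_zero]
        exact (hQ i).2.2
    · exact Current.isRectifiable_boundary_of_tendsto_succ
        (fun S S' hS hSconv => ih hK hc hS hSconv) hT hconv

end Closure

/-! ### The compactness theorem -/

section Compactness

/-- **Federer–Fleming compactness for integral currents** [Federer1969, 4.2.17 (2)]: the named
fact `Federer1969_compactness_integralCurrents` holds — by
`Federer1969_compactness_of_rectifiableLimit` it suffices that weak limits of `𝐍`-bounded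
sequences of integral currents supported in a compact set are rectifiable, which is the closure
theorem `Current.isRectifiable_of_tendsto_integral` (proved along [White1989], without the
structure theorem). [cite: Federer1969, 4.2.17 (2); White1989, Theorem p. 207] -/
theorem Federer1969_compactness_integralCurrents_holds : Federer1969_compactness_integralCurrents :=
  Federer1969_compactness_of_rectifiableLimit fun _ _ _ _ _ _ m _ hK _ hc _ _ hT hconv =>
    Current.isRectifiable_of_tendsto_integral m hK hc hT hconv

end Compactness

end Literature.Geometry.GeometricMeasureTheory
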